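import Literature.Probability.RandomPlanarGeometry.ChordalUniformizerKernel
import HarnessLib

/-!
# Chordal uniformizing maps of kernel-convergent approximating domains, for a given limit map

Topic `Literature/Probability/RandomPlanarGeometry` (family `crit-ising`); one theorem, no
definition, no named fact. `ChordalUniformizerKernel.lean` packages Pommerenke's Cor. 2.4 for
Dobrushin domains `(D_n; a_n, b_n) → (D; a, b)` converging in the kernel sense with uniformly
locally connected complements as `MarkedDomain.exists_uniformizers_of_kernel`: it PRODUCES a
chordal uniformizing map `φ` of the limit domain together with maps `φ_n` of the approximating
domains whose boundary extensions converge ((U1) on the closed half-plane, uniformly on its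
compacts, and (U2) at infinity) — the domain-approximation hypotheses `hU1`, `hU2` of
Kemppainen–Smirnov's theorem for curves in approximating domains
(`ae_isLoewnerDescribable_and_tendstoInDistribution_drivingPath_varying`, KS Cor. 1.8;
Chelkak–Duminil-Copin–Hongler–Kemppainen–Smirnov, C. R. Math. 352 (2014), §3, "`φ^δ → φ`").

Consumers that quantify over an ARBITRARY chordal uniformizing map `φ` of `(D; a, b)` — the
lattice-data hypotheses of `LatticeModels.exists_observableMartingale_fkInterface_of_latticeData`
(item 1) and their bond-percolation twins, which must read the discrete interfaces through maps
`φ_n → φ` for the `φ` HANDED to them — need the same conclusion for their `φ`. Two chordal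
uniformizing maps differ by a dilation of `ℍ`, and the normalised form of the kernel theorem,
`MarkedDomain.tendstoUniformlyOn_boundaryExtension_of_kernel`, is stated for maps with
`|φ⁻¹(z₀)| = |φ_n⁻¹(z₀)| = 1` at a common interior point `z₀`; taking `z₀ = φ(i)` (so that
`|φ⁻¹(z₀)| = |i| = 1`, and `z₀ ∈ D_n` for large `n` by (K1) applied to `{z₀}`) gives the result
for the given `φ`: `MarkedDomain.exists_uniformizers_of_kernel_of_isChordalUniformizing`. The
proof is that of `exists_uniformizers_of_kernel` verbatim with this choice of `z₀`.

## References

* Ch. Pommerenke, *Boundary Behaviour of Conformal Maps* (1992), §2.2 Prop. 2.3, Cor. 2.4.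
  [PommerenkeBBCM1992]
* A. Kemppainen, S. Smirnov, Ann. Probab. 45 (2017), Cor. 1.8. [KemppainenSmirnov2017]
* D. Chelkak, H. Duminil-Copin, C. Hongler, A. Kemppainen, S. Smirnov, C. R. Math. Acad. Sci.
  Paris 352 (2014) 157–161, §3. [CDHKSCRAS2014]
-/

noncomputable section

open Set Function Filter Metric Complex
open _root_.Topology
open UpperHalfPlane (upperHalfPlaneSet)

namespace Literature.Probability.RandomPlanarGeometry

namespace MarkedDomain

variable {D : DobrushinDomain} {Ds : ℕ → DobrushinDomain}

/-- **Chordal uniformizing maps with (U1), (U2) exist for kernel-convergent approximating Jordan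
domains, relative to a GIVEN chordal uniformizing map of the limit domain.** Under (B) uniform
boundedness, (K1) compacts of `D` eventually in `D_n`, (K2) no disc about a point off `D`
eventually in `D_n`, (ULC) uniform local connectedness of the complements, `a_n → a` and
`b_n → b`: for EVERY chordal uniformizing map `φ` of `(D; a, b)` there are chordal uniformizing
maps `φ_n` of `(D_n; a_n, b_n)` whose boundary extensions converge to that of `φ` uniformly on
the closed half-plane (in particular on its compacts `{0 ≤ im} ∩ closedBall 0 R`) and uniformly at
infinity (`dist (Φ_n z) b_n ≤ ε` for `‖z‖ ≥ r`, large `n`) — exactly the hypotheses `hφs`, `hU1`,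
`hU2` of `ae_isLoewnerDescribable_and_tendstoInDistribution_drivingPath_varying` for this `φ`.
Proof: `tendstoUniformlyOn_boundaryExtension_of_kernel` at the interior point `z₀ = φ(i)`, where
`|φ⁻¹(z₀)| = 1`, with the approximating maps normalised by `|φ_n⁻¹(z₀)| = 1`
(`exists_isChordalUniformizing_norm_symm_eq_one`) for the indices with `z₀ ∈ D_n` and arbitrary
ones for the finitely many others. [cite: PommerenkeBBCM1992, Cor. 2.4]
[cite: KemppainenSmirnov2017, Cor. 1.8] -/
theorem exists_uniformizers_of_kernel_of_isChordalUniformizing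
    (hB : ∃ R > 0, ∀ᶠ n in atTop, (Ds n).carrier ⊆ ball 0 R)
    (hK1 : ∀ K : Set ℂ, IsCompact K → K ⊆ D.carrier → ∀ᶠ n in atTop, K ⊆ (Ds n).carrier)
    (hK2 : ∀ w ∉ D.carrier, ∀ r : ℝ, 0 < r → ∀ᶠ n in atTop, ¬ ball w r ⊆ (Ds n).carrier)
    (hlc : ∀ η : ℝ, 0 < η → ∃ ε > 0, ∀ᶠ n in atTop, ∀ a ∈ frontier (Ds n).carrier,
      ∀ b ∈ frontier (Ds n).carrier, dist a b < ε → ∃ σ ⊆ (Ds n).carrierᶜ, IsCompact σ ∧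
        IsPreconnected σ ∧ a ∈ σ ∧ b ∈ σ ∧ σ ⊆ closedBall a η)
    (ha : Tendsto (fun n ↦ (Ds n).pt 0) atTop (𝓝 (D.pt 0)))
    (hb : Tendsto (fun n ↦ (Ds n).pt 1) atTop (𝓝 (D.pt 1)))
    (φ : ConformalEquiv upperHalfPlaneSet D.carrier) (hφ : D.IsChordalUniformizing φ) :
    ∃ φs : ∀ n, ConformalEquiv upperHalfPlaneSet (Ds n).carrier,
      (∀ n, (Ds n).IsChordalUniformizing (φs n)) ∧
      TendstoUniformlyOn (fun n ↦ (φs n).boundaryExtension) φ.boundaryExtension atTop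
        {z : ℂ | 0 ≤ z.im} ∧
      (∀ R : ℝ, TendstoUniformlyOn (fun n ↦ (φs n).boundaryExtension) φ.boundaryExtension atTop
        ({z : ℂ | 0 ≤ z.im} ∩ closedBall 0 R)) ∧
      ∀ ε : ℝ, 0 < ε → ∃ r : ℝ, ∀ᶠ n in atTop, ∀ z : ℂ, z ∈ {z : ℂ | 0 ≤ z.im} → r ≤ ‖z‖ →
        dist ((φs n).boundaryExtension z) ((Ds n).pt 1) ≤ ε := by
  classical
  -- the interior point `z₀ = φ(i)`, at which `φ` is normalised
  have hI : (I : ℂ) ∈ upperHalfPlaneSet := by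
    show 0 < (I : ℂ).im
    simp
  set z₀ : ℂ := φ I with hz₀def
  have hz₀ : z₀ ∈ D.carrier := φ.mapsTo hI
  have hφ1 : ‖φ.symm z₀‖ = 1 := by
    rw [hz₀def, φ.symm_apply_apply hI, norm_I]
  have hz₀n : ∀ᶠ n in atTop, z₀ ∈ (Ds n).carrier :=
    (hK1 {z₀} isCompact_singleton (singleton_subset_iff.2 hz₀)).mono
      fun n hn ↦ hn (mem_singleton z₀)
  obtain ⟨N₀, hN₀⟩ := eventually_atTop.1 hz₀n
  -- normalised maps for the good indices, arbitrary ones elsewhere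
  have hgood : ∀ n, ∃ ψ : ConformalEquiv upperHalfPlaneSet (Ds n).carrier,
      (Ds n).IsChordalUniformizing ψ ∧ (N₀ ≤ n → ‖ψ.symm z₀‖ = 1) := by
    intro n
    by_cases hn : N₀ ≤ n
    · obtain ⟨ψ, hψ, hψ1⟩ := exists_isChordalUniformizing_norm_symm_eq_one (Ds n) (hN₀ n hn)
      exact ⟨ψ, hψ, fun _ ↦ hψ1⟩
    · obtain ⟨ψ, hψ⟩ := exists_isChordalUniformizing_holds (Ds n)
      exact ⟨ψ, hψ, fun h ↦ (hn h).elim⟩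
  choose φs hφs hφs1 using hgood
  -- the shifted sequence satisfies the hypotheses of the normalised theorem
  have hT := tendsto_add_atTop_nat N₀
  have hB' : ∃ R > 0, ∀ᶠ n in atTop, (Ds (n + N₀)).carrier ⊆ ball 0 R := by
    obtain ⟨R, hR, h⟩ := hB; exact ⟨R, hR, hT.eventually h⟩
  have hK1' : ∀ K : Set ℂ, IsCompact K → K ⊆ D.carrier →
      ∀ᶠ n in atTop, K ⊆ (Ds (n + N₀)).carrier :=
    fun K hK hKD ↦ hT.eventually (hK1 K hK hKD)
  have hK2' : ∀ w ∉ D.carrier, ∀ r : ℝ, 0 < r →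
      ∀ᶠ n in atTop, ¬ ball w r ⊆ (Ds (n + N₀)).carrier :=
    fun w hw r hr ↦ hT.eventually (hK2 w hw r hr)
  have hlc' : ∀ η : ℝ, 0 < η → ∃ ε > 0, ∀ᶠ n in atTop, ∀ a ∈ frontier (Ds (n + N₀)).carrier,
      ∀ b ∈ frontier (Ds (n + N₀)).carrier, dist a b < ε → ∃ σ ⊆ (Ds (n + N₀)).carrierᶜ,
        IsCompact σ ∧ IsPreconnected σ ∧ a ∈ σ ∧ b ∈ σ ∧ σ ⊆ closedBall a η := by
    intro η hη; obtain ⟨ε, hε, h⟩ := hlc η hη; exact ⟨ε, hε, hT.eventually h⟩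
  have hshift := tendstoUniformlyOn_boundaryExtension_of_kernel
    (Ds := fun n ↦ Ds (n + N₀)) hB' hK1' hK2' hlc'
    (ha.comp (tendsto_add_atTop_nat N₀)) (hb.comp (tendsto_add_atTop_nat N₀)) hz₀
    (fun n ↦ hN₀ (n + N₀) (Nat.le_add_left _ _)) φ hφ hφ1 (fun n ↦ φs (n + N₀))
    (fun n ↦ hφs (n + N₀)) (fun n ↦ hφs1 (n + N₀) (Nat.le_add_left _ _))
  obtain ⟨hU1', hU2'⟩ := hshift
  have hU1 : TendstoUniformlyOn (fun n ↦ (φs n).boundaryExtension) φ.boundaryExtension atTop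
      {z : ℂ | 0 ≤ z.im} := by
    rw [Metric.tendstoUniformlyOn_iff] at hU1' ⊢
    intro ε hε
    have h2 : ∀ᶠ n in Filter.map (fun n ↦ n + N₀) atTop,
        ∀ x ∈ {z : ℂ | 0 ≤ z.im}, dist (φ.boundaryExtension x) ((φs n).boundaryExtension x) < ε :=
      Filter.eventually_map.2 (hU1' ε hε)
    rwa [Filter.map_add_atTop_eq_nat N₀] at h2
  refine ⟨φs, hφs, hU1, fun R ↦ hU1.mono inter_subset_left, fun ε hε ↦ ?_⟩
  obtain ⟨r, hr⟩ := hU2' ε hε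
  refine ⟨r, ?_⟩
  have h2 : ∀ᶠ n in Filter.map (fun n ↦ n + N₀) atTop, ∀ z : ℂ, z ∈ {z : ℂ | 0 ≤ z.im} →
      r ≤ ‖z‖ → dist ((φs n).boundaryExtension z) ((Ds n).pt 1) ≤ ε :=
    Filter.eventually_map.2 hr
  rwa [Filter.map_add_atTop_eq_nat N₀] at h2

end MarkedDomain

end Literature.Probability.RandomPlanarGeometry
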